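import Literature.NumberTheory.EllipticCurves.ManinConstantModularDegree
import Summits.BirchSwinnertonDyer.Rank1Residual.ManinAdditive.WildResiduals
import HarnessLib
import HarnessLib.Audit.Tags

/-!
# E-imc-193 — the CNS inequality at 2 OFF the powers of two (paper theorem COR 29.AN, PROOFS-g25 §6),
# typed v-uniformly, and its two book-keeping edges: (a) it implies E-imc-191 for every conductor with an odd
# prime factor; (b) it proves `ManinOddAtFour`'s conclusion on the slice «odd modular degree».
Statement-only candidate row (E-imc-193 `CNSInequalityAtTwoOffPowersOfTwo`); nothing here is a route item.  (cell `bsd-f2-manin`, planner `imc` g25,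
Sketch-imc-g25; T-imc-43)

TYPER NOTE (typer g20, T-imc-43).  SOURCE = HOME/imc/kit-g25/Sketch-imc-g25.lean sha16 f1c1251a64e38db4 (64 l.; imc: farm rc 0 · 0 s∗rries) VERBATIM
except this note and the attribute `@[conjecture]` on the research node (cell convention for beyond-print rows, as E-imc-190/191 in the sibling
`WildResiduals.lean`; body untouched).  Statement-only candidate row **E-imc-193 `CNSInequalityAtTwoOffPowersOfTwo`**: the Česnavičius–Neururer–Saha
inequality `v₂(c_φ) ≤ v₂(deg φ)` for EVERY conductor-level parametrisation datum whose conductor has an odd prime factor (no congruence condition,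
every `v₂(N)`) — imc's PAPER theorem COR 29.AN (PROOFS-g25 §4–§6: THM 29.AK «𝔖_{2ⁿ} is a D₄ rational double point for all n ≥ 2» ⟹ COR 29.AM ⟹
COR 29.AN; HOME/imc/kit-g25/PROOFS-g25.md bedd353b21bdcd08), refuter audit R-imc-85 PENDING at landing time ⇒ obligation node until audited /
kernel-checked; census (imc): 47365/47365 Cremona classes with `v₂(N) ≥ 3` in CNS's excluded class have `c = 1`.  PROVED (imc, bookkeeping):
`cnsInequalityWildTwo_of_offPowersOfTwo` (E-imc-193 ⟹ the E-imc-191 `WildResiduals.CNSInequalityWildTwo` shape restricted to conductors with an odd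
prime factor) and `not_two_dvd_maninConstant_of_odd_modularDegree` (E-imc-193 ⟹ the CONCLUSION of crux C2 `ManinOddAtFour` on the slice «odd modular
degree, conductor not a power of 2», no optimality needed).  Typer checks: decl names fresh in the tree; imports = `Literature…ManinConstantModularDegree`
+ the landed `…ManinAdditive.WildResiduals` (+ HarnessLib) — route-independent ManinAdditive cone; no instances, no notation; own farm check rc 0 · 0
warnings.  In print nearby: [CesnaviciusNeururerSaha] Thm 1.2 (main-general; the tree's `Literature…ManinConstantModularDegree`) covers the conductors
OUTSIDE CNS's excluded class — E-imc-193 is the excluded class at 2 off the powers of two, NOT in print.  PARTITION 0 · beyond-print theorem: no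
(paper candidate) · bears_on stmt-BirchSwinnertonDyer-22967 (C2 `ManinOddAtFour`, slice edge (b)) · BSD is not proved by this; Manin `c = 1` is not
proved by this; E-imc-193, C2 OPEN.
-/

noncomputable section

namespace Summit.BirchSwinnertonDyer.Rank1Residual.ManinAdditive.WildTwoOffPowers

open Literature.NumberTheory.EllipticCurves.ModularForms
open Summit.BirchSwinnertonDyer.Rank1Residual.ManinAdditive.WildResiduals

/-- candidate **E-imc-193** (imc g25, PROOFS-g25 §4–§6: THM 29.AK ⟹ COR 29.AM ⟹ COR 29.AN, paper, audit R-imc-85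
pending): the Česnavičius–Neururer–Saha inequality at `p = 2` for EVERY conductor-level parametrisation datum whose
conductor has an odd prime factor (no congruence condition, every `v₂(N)`).  Why it might fail: only if THM 29.AK
(«𝔖_{2ⁿ} is a D₄ rational double point for all n ≥ 2») or the printed wording of CNS Thm 1.2 (main-general) fails.
Census: 47365/47365 Cremona classes with `v₂(N) ≥ 3` in CNS's excluded class have `c = 1`.
[conjecture: this programme — imc PROOFS-g25 COR 29.AN, paper] -/
@[conjecture]
def CNSInequalityAtTwoOffPowersOfTwo : Prop :=
  ∀ (W : WeierstrassCurve ℚ) [W.IsElliptic] [W.IsGloballyMinimal] [NeZero (W.conductorNorm ℤ)]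
    (D : ModularParametrizationData W (W.conductorNorm ℤ)),
    (∃ q : ℕ, q.Prime ∧ q ≠ 2 ∧ q ∣ W.conductorNorm ℤ) →
    padicValInt 2 D.maninConstant ≤ padicValNat 2 D.modularDegree

/-- PROVED edge (a): E-imc-193 ⟹ E-imc-191 restricted to conductors with an odd prime factor. -/
theorem cnsInequalityWildTwo_of_offPowersOfTwo (h : CNSInequalityAtTwoOffPowersOfTwo)
    (W : WeierstrassCurve ℚ) [W.IsElliptic] [W.IsGloballyMinimal] [NeZero (W.conductorNorm ℤ)]
    (D : ModularParametrizationData W (W.conductorNorm ℤ))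
    (hq : ∃ q : ℕ, q.Prime ∧ q ≠ 2 ∧ q ∣ W.conductorNorm ℤ)
    (_h8 : 2 ^ 3 ∣ W.conductorNorm ℤ) (_hc : ∀ q : ℕ, q.Prime → q ∣ W.conductorNorm ℤ → q % 4 ≠ 3) :
    padicValInt 2 D.maninConstant ≤ padicValNat 2 D.modularDegree :=
  h W D hq

/-- PROVED edge (b): E-imc-193 proves the CONCLUSION of the crux `ManinOddAtFour` (stmt-22967) on the slice
«conductor-level datum of odd modular degree whose conductor has an odd prime factor» (no optimality needed). -/
theorem not_two_dvd_maninConstant_of_odd_modularDegree (h : CNSInequalityAtTwoOffPowersOfTwo)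
    (W : WeierstrassCurve ℚ) [W.IsElliptic] [W.IsGloballyMinimal] [NeZero (W.conductorNorm ℤ)]
    (D : ModularParametrizationData W (W.conductorNorm ℤ))
    (hq : ∃ q : ℕ, q.Prime ∧ q ≠ 2 ∧ q ∣ W.conductorNorm ℤ)
    (hodd : ¬ 2 ∣ D.modularDegree) (hc0 : D.maninConstant ≠ 0) :
    ¬ (2 : ℤ) ∣ D.maninConstant := by
  intro h2
  have hle := h W D hq
  have hdeg : padicValNat 2 D.modularDegree = 0 :=
    padicValNat.eq_zero_of_not_dvd hodd
  have hpos : 0 < padicValInt 2 D.maninConstant := by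
    rw [padicValInt]
    have : 1 ≤ padicValNat 2 D.maninConstant.natAbs := by
      have hne : D.maninConstant.natAbs ≠ 0 := Int.natAbs_ne_zero.mpr hc0
      have hdvd : 2 ∣ D.maninConstant.natAbs := by
        have := Int.natAbs_dvd_natAbs.mpr h2
        simpa using this
      exact (padicValNat_dvd_iff_le hne).mp (by simpa using hdvd)
    omega
  omega

end Summit.BirchSwinnertonDyer.Rank1Residual.ManinAdditive.WildTwoOffPowers

end
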